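import Summits.QuantumFields.YangMills.Theorems.BalabanUVNodesN15TwoSpacingGluingCurvedKnitCovariantLandauNodeFlatRows
import Summits.QuantumFields.YangMills.Theorems.BalabanUVNodesN15CovariantLandauFlatRowsKing
import HarnessLib

/-!
# THE GLUING STEP AT TWO LATTICE SPACINGS — PROGRAMME (P-S), XI: NE2⁺ (OPERATOR LAYER) FOR THE GLUED FAMILY WITH BAŁABAN's FULLY COVARIANT SUMMAND LIVE, THE THREE FLAT KERNEL ROWS
# OF THE LANDAU LETTER's PRIMITIVE FAMILY PROVED (King-model rung, n15-c∕220) — displayed now: per grid ONE flat row `(Q′G′²Q′ᵀ)⁻¹(1)` ([B6] Prop. 2.3) and ONE covariant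
# gradient-difference row ([B9] Thm 3.4), the two-grid η-defect row, entries 1–3 (dag-n15-c g23, n15-c∕221)

Cell `pub-ymgap`, seat `pub-ymgap-dag-n15-c` (R134 (a); HUMAN RULING D-0062), generation 23.  `bears_on: R4∕N15 · K3⁸ SpineGivenEndpointR13SepCoPHV (stmt-QuantumFields-27366)`.
Filed `--supports stmt-QuantumFields-27366 --as helper` — COUNT-NEUTRAL.  One theorem; 0 `sorry`.  Imports BY NAME n15-c∕219 v1.1 (`ne2PlusOperator_sfqr_of_flatRows_mass`) and n15-c∕220
(`CovLandau.flatKernelRows_king`: the rows of `G′(1)`, `∂G′(1)`, `G′(1)∂ᵀ` PROVED on King's torus family from dag-n15-e's `fullPropOp∕DOp∕AdjOp_sup_decay`), `King1986.aK_pos∕aK_le`.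
Nothing in the tree is modified.

WHY.  n15-c∕219 displayed four flat rows per grid; n15-c∕220 proves three of them on exactly the cover's tori (`cvM = 2L^{m+1}` per direction — `rfl` — with `n = L^{kk}`, `kk ≥ 1`, and
`n′ = L^r·L^{kk} = L^{r+kk}`) at King's masses `a_K(1, L, K)·n^{d+1} ∈ (0, n^{d+1}]`.  THIS FILE plugs them in: `NE2PlusOperator c₃₅ (sfInstance …) (sfqrFamily …)` from (`hE`) entries 1–3;
(`hS`) per index and grid the ONE flat row `(Q′G′²Q′ᵀ)⁻¹(1) ≤ C_S·n^{d+1}·e^{−δd}` at King's mass and, for class-(3.35) fields below a threshold, the ONE covariant gradient-difference row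
`D_TG′(T) − ∂G′(1) ≤ P₀·c₃₅L^mα₀·e^{−δd}`; (`hD`) the two-grid η-defect row of `N_V^R`.
* ★★★ **`ne2PlusOperator_sfqr_of_sopRow`**.

HONEST FRAMING ∕ LIMITS.  Plumbing + dag-n15-e's King-model theorems (King's `A = 0` scalar model read on Bałaban's flat objects through an exact dictionary); MODEL carriers (doubled-torus
cover, global small-field gauge, one averaging level, unit weights, site transporters); the `(Q′G′²Q′ᵀ)⁻¹` rows, the gradient-difference rows, the defect row and entries 1–3 are HYPOTHESES;
NOT [Balaban1985BackgroundPropagators] Thm 3.1∕3.14 as printed; NE2⁺ NOT PRINTED; N15 of record untouched (DISCHARGED AS CONSUMED, p687738); counts UNMOVED (typed 28∕28 · discharged 8∕27);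
one finite 𝕋⁴ at fixed ε per index — NOT infinite volume ∕ OS ∕ mass gap ∕ Clay.  Restate-immune (no Theses import).
-/

noncomputable section

open scoped BigOperators Matrix

namespace Summit.QuantumFields.YangMills.BalabanUVNodes.N15.Gluing

open Literature.MathematicalPhysics.QuantumFieldTheory.Balaban1983to89
open Literature.MathematicalPhysics.QuantumFieldTheory.Balaban1983to89.B11SectG (BlockNorm HasMaj)
open Literature.MathematicalPhysics.QuantumFieldTheory.Balaban1983to89.T4EtaRateDefect (idef)
open Literature.MathematicalPhysics.QuantumFieldTheory.Balaban1983to89.T4EtaRateCoeffDefect (pull)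
open Literature.MathematicalPhysics.QuantumFieldTheory.Balaban1983to89.B6UnitTorusCarrier (unitTorusGeo unitTorusGeo_dist_nonneg)
open Literature.MathematicalPhysics.QuantumFieldTheory.Balaban1983to89.B5Prop11Plancherel (Tor fine)
open Literature.MathematicalPhysics.QuantumFieldTheory.Balaban1983to89.T4EtaRate (NE2PlusOperator rateFactor)
open Literature.MathematicalPhysics.QuantumFieldTheory.King1986 (aK aK_pos aK_le)
open Literature.MathematicalPhysics.QuantumFieldTheory.King1986.Torus (blockOf tdistT)
open Literature.Barriers.QuantumFields (traceForm)
open Summit.QuantumFields.YangMills.BalabanUVNodes.N15.BackgroundLayer (gavgM)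
open Summit.QuantumFields.YangMills.BalabanUVNodes.N15.VectorPiece (kingPrV)
open Summit.QuantumFields.YangMills.BalabanUVNodes.N15.MatrixSpecies (liftBlk liftMap)
open Summit.QuantumFields.YangMills.BalabanUVNodes.N15.OperatorReadout (opGeo)
open Summit.QuantumFields.YangMills.BalabanUVNodes.N15.CovLandau (cgrad csavg cGreen cSop flatKernelRows_king)

variable {d : ℕ} {L : ℕ} [NeZero L]

section Node

open scoped Matrix.Norms.L2Operator

variable (d) (mm ι : Type) [Fintype mm] [DecidableEq mm] [Nonempty mm] [Fintype ι] [DecidableEq ι] (e : Matrix mm mm ℂ ≃L[ℝ] (ι → ℝ))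

/-- ★★★ **NE2⁺, OPERATOR LAYER, BY NAME, FOR THE GLUED FAMILY WITH BAŁABAN's FULLY COVARIANT SUMMAND LIVE — THE THREE FLAT KERNEL ROWS PROVED.**  n15-c∕219 v1.1 fed by n15-c∕220 on
both grids at King's masses `a_K(1, L, kk)·n^{d+1}`, `a_K(1, L, r+kk)·n′^{d+1}`; displayed: per grid the flat row of `(Q′G′²Q′ᵀ)⁻¹(1)` and the covariant gradient difference (`hS`), the two-grid
η-defect row (`hD`), entries 1–3 (`hE`).  MODEL family; NOT [B9] Thm 3.1∕3.14 as printed.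
[cite: Balaban1985BackgroundPropagators, Thm 3.1 (3.42) p.397, (3.49) p.399, Thm 3.4 p.400, Thm 3.14 pp.426–427; Balaban1984PropagatorsII, Prop. 2.3 p.231 (shape of the displayed row); Balaban1983RegularityDecay, Theorem (1.10) p.573; King1986, Thm 3.3 p.656, Prop. 3.9 (3.73) p.665] -/
theorem ne2PlusOperator_sfqr_of_sopRow (hL : Odd L ∧ 1 < L) (hL7 : 7 ≤ L) {a : ℝ} (ha : 0 < a) {c35 : ℝ} (hc35 : 0 < c35) (he : ∀ A B : Matrix mm mm ℂ, traceForm A B = e A ⬝ᵥ e B)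
    (E : ∀ i : SfIdx d L, Fin 4 → (Fin (d + 1) → CvX' d L i.m i.kk i.r hL → Matrix mm mm ℂ) → ((CvX d L i.m i.kk hL × ι → ℝ) →ₗ[ℝ] (CvX' d L i.m i.kk i.r hL × ι → ℝ)))
    (hE : ∃ M₁ δ₁ a₁ B₁ γ₁ : ℝ, 0 < M₁ ∧ 0 < δ₁ ∧ 0 < a₁ ∧ 0 < B₁ ∧ 0 < γ₁ ∧
      ∀ i : SfIdx d L, M₁ ≤ (L : ℝ) ^ i.m → ∀ α₀ : ℝ, 0 < α₀ → (L : ℝ) ^ i.m * α₀ ≤ a₁ →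
        ∀ A' : Fin (d + 1) → CvX' d L i.m i.kk i.r hL → Matrix mm mm ℂ, (sfInstance d mm ι hL i).Bf.Reg335 c35 α₀ A' → ∀ n : Fin 4, n ≠ 0 →
          HasMaj (BlockNorm.ofBlocks (sfGeo d hL i) (liftBlk (cvBlk d L i.m i.kk hL) ι))
            (BlockNorm.ofBlocks (sfGeo d hL i) (liftBlk (cvBlk d L i.m i.kk hL ∘ kingPrV L i.kk i.r (cvM d L i.m i.kk hL)) ι)) (E i n A')
            (fun y y' => B₁ * B9.pref4 ((opGeo (sfGeo d hL i) (CvX d L i.m i.kk hL × ι) (liftBlk (cvBlk d L i.m i.kk hL) ι)).len y) n * Real.exp (-(δ₁ * (sfGeo d hL i).dist y y')) *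
              max (rateFactor (opGeo (sfGeo d hL i) (CvX d L i.m i.kk hL × ι) (liftBlk (cvBlk d L i.m i.kk hL) ι)) γ₁ y)
                (rateFactor (opGeo (sfGeo d hL i) (CvX d L i.m i.kk hL × ι) (liftBlk (cvBlk d L i.m i.kk hL) ι)) γ₁ y')))
    (hS : ∃ δ₂ CS P0 aP : ℝ, 0 < δ₂ ∧ 0 ≤ CS ∧ 0 ≤ P0 ∧ 0 < aP ∧ ∀ i : SfIdx d L,
        HasMaj (BlockNorm.ofBlocks (unitTorusGeo L i.kk (cvM d L i.m i.kk hL)) (liftBlk (fun y : Tor (cvM d L i.m i.kk hL) => y) ι)) (BlockNorm.ofBlocks (unitTorusGeo L i.kk (cvM d L i.m i.kk hL)) (liftBlk (fun y : Tor (cvM d L i.m i.kk hL) => y) ι)) (Matrix.mulVecLin (cSop (cvM d L i.m i.kk hL) (L ^ i.kk) (fun (_ : Fin (d + 1)) (_ : Tor (fine (L ^ i.kk) (cvM d L i.m i.kk hL))) => (1 : Matrix ι ι ℝ)) (aK 1 (L : ℝ) i.kk * ((L ^ i.kk : ℕ) : ℝ) ^ (d + 1)))⁻¹) (fun y y' =>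 CS * ((L ^ i.kk : ℕ) : ℝ) ^ (d + 1) * Real.exp (-(δ₂ * (unitTorusGeo L i.kk (cvM d L i.m i.kk hL)).dist y y'))) ∧
        HasMaj (BlockNorm.ofBlocks (unitTorusGeo L i.kk (cvM d L i.m i.kk hL)) (liftBlk (fun y : Tor (cvM d L i.m i.kk hL) => y) ι)) (BlockNorm.ofBlocks (unitTorusGeo L i.kk (cvM d L i.m i.kk hL)) (liftBlk (fun y : Tor (cvM d L i.m i.kk hL) => y) ι)) (Matrix.mulVecLin (cSop (cvM d L i.m i.kk hL) (L ^ i.r * L ^ i.kk) (fun (_ : Fin (d + 1)) (_ : Tor (fine (L ^ i.r * L ^ i.kk) (cvM d L i.m i.kk hL))) => (1 : Matrix ι ι ℝ)) (aK 1 (L : ℝ) (i.r + i.kk) * ((L ^ i.r * L ^ i.kk : ℕ) : ℝ) ^ (d + 1)))⁻¹) (fun y y' => CS * ((L ^ i.r * L ^ i.kk : ℕ) : ℝ) ^ (d + 1) * Real.exp (-(δ₂ * (unitTorusGeo L i.kk (cvM d L i.m i.kk hL)).dist y y'))) ∧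
        (∀ α₀ : ℝ, 0 < α₀ → (L : ℝ) ^ i.m * α₀ ≤ aP → ∀ A' : Fin (d + 1) → CvX' d L i.m i.kk i.r hL → Matrix mm mm ℂ, (sfInstance d mm ι hL i).Bf.Reg335 c35 α₀ A' →
          HasMaj (BlockNorm.ofBlocks (unitTorusGeo L i.kk (cvM d L i.m i.kk hL)) (liftBlk (blockOf (L ^ i.kk) (cvM d L i.m i.kk hL)) ι)) (BlockNorm.ofBlocks (unitTorusGeo L i.kk (cvM d L i.m i.kk hL)) (liftBlk (fun b : Tor (fine (L ^ i.kk) (cvM d L i.m i.kk hL)) × Fin (d + 1) => blockOf (L ^ i.kk) (cvM d L i.m i.kk hL) b.1) ι)) (Matrix.mulVecLin (cgrad (cvM d L i.m i.kk hL) (L ^ i.kk) (cvT₀ e (fun μ x => NormedSpace.exp (((((L ^ i.kk : ℕ) : ℝ))⁻¹) • gavgM (Matrix mm mm ℂ) (Fin (d + 1)) (kingPrV L i.kk i.r (cvM d L i.m i.kk hL)) A' μ x))) * cGreen (cvM d L i.m i.kk hL) (L ^ i.kk) (cvT₀ e (fun μ x => NormedSpace.exp (((((L ^ i.kk : ℕ)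 : ℝ))⁻¹) • gavgM (Matrix mm mm ℂ) (Fin (d + 1)) (kingPrV L i.kk i.r (cvM d L i.m i.kk hL)) A' μ x))) (aK 1 (L : ℝ) i.kk * ((L ^ i.kk : ℕ) : ℝ) ^ (d + 1)) - cgrad (cvM d L i.m i.kk hL) (L ^ i.kk) (fun (_ : Fin (d + 1)) (_ : Tor (fine (L ^ i.kk) (cvM d L i.m i.kk hL))) => (1 : Matrix ι ι ℝ)) * cGreen (cvM d L i.m i.kk hL) (L ^ i.kk) (fun (_ : Fin (d + 1)) (_ : Tor (fine (L ^ i.kk) (cvM d L i.m i.kk hL))) => (1 : Matrix ι ι ℝ)) (aK 1 (L : ℝ) i.kk * ((L ^ i.kk : ℕ) : ℝ) ^ (d + 1)))) (fun y y' => P0 * (c35 * (L : ℝ) ^ i.m * α₀) * Real.exp (-(δ₂ * (unitTorusGeo L i.kk (cvM d L i.m i.kk hL)).dist y y'))) ∧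
          HasMaj (BlockNorm.ofBlocks (unitTorusGeo L i.kk (cvM d L i.m i.kk hL)) (liftBlk (blockOf (L ^ i.r * L ^ i.kk) (cvM d L i.m i.kk hL)) ι)) (BlockNorm.ofBlocks (unitTorusGeo L i.kk (cvM d L i.m i.kk hL)) (liftBlk (fun b : Tor (fine (L ^ i.r * L ^ i.kk) (cvM d L i.m i.kk hL)) × Fin (d + 1) => blockOf (L ^ i.r * L ^ i.kk) (cvM d L i.m i.kk hL) b.1) ι)) (Matrix.mulVecLin (cgrad (cvM d L i.m i.kk hL) (L ^ i.r * L ^ i.kk) (cvT₀ e (fun μ x' => NormedSpace.exp (((((L ^ i.r * L ^ i.kk : ℕ) : ℝ))⁻¹) • A' μ x'))) * cGreen (cvM d L i.m i.kk hL) (L ^ i.r * L ^ i.kk) (cvT₀ e (fun μ x' => NormedSpace.exp (((((L ^ i.r * L ^ i.kk : ℕ) : ℝ))⁻¹) • A' μ x'))) (aK 1 (L : ℝ) (i.r + i.kk) * ((L ^ i.r * L ^ i.kk : ℕ) : ℝ) ^ (d + 1)) - cgrad (cvM d L i.m i.kk hL) (L ^ i.r * L ^ i.kk) (fun (_ : Fin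 (d + 1)) (_ : Tor (fine (L ^ i.r * L ^ i.kk) (cvM d L i.m i.kk hL))) => (1 : Matrix ι ι ℝ)) * cGreen (cvM d L i.m i.kk hL) (L ^ i.r * L ^ i.kk) (fun (_ : Fin (d + 1)) (_ : Tor (fine (L ^ i.r * L ^ i.kk) (cvM d L i.m i.kk hL))) => (1 : Matrix ι ι ℝ)) (aK 1 (L : ℝ) (i.r + i.kk) * ((L ^ i.r * L ^ i.kk : ℕ) : ℝ) ^ (d + 1)))) (fun y y' => P0 * (c35 * (L : ℝ) ^ i.m * α₀) * Real.exp (-(δ₂ * (unitTorusGeo L i.kk (cvM d L i.m i.kk hL)).dist y y')))))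
    (hD : ∃ δD CR γR aD : ℝ, 0 < δD ∧ 0 ≤ CR ∧ 0 < γR ∧ 0 < aD ∧
      ∀ i : SfIdx d L, ∀ α₀ : ℝ, 0 < α₀ → (L : ℝ) ^ i.m * α₀ ≤ aD → ∀ A' : Fin (d + 1) → CvX' d L i.m i.kk i.r hL → Matrix mm mm ℂ, (sfInstance d mm ι hL i).Bf.Reg335 c35 α₀ A' →
        HasMaj (CvNorm d L i.m i.kk hL ι) (BlockNorm.ofBlocks (unitTorusGeo L i.kk (cvM d L i.m i.kk hL)) (liftBlk (cvBlk d L i.m i.kk hL ∘ (kingPrV L i.kk i.r (cvM d L i.m i.kk hL))) ι)) (idef (pull (liftMap (kingPrV L i.kk i.r (cvM d L i.m i.kk hL)) ι)) (pull (liftMap (kingPrV L i.kk i.r (cvM d L i.m i.kk hL)) ι)) (cvNVr' d L i.m i.kk i.r hL a ι e (fun μ x' => NormedSpace.exp (((((L ^ i.r * L ^ i.kk : ℕ) : ℝ))⁻¹) • A' μ x'))) (cvNVr d L i.m i.kk hL a ι e (fun μ x => NormedSpace.exp (((((L ^ i.kk : ℕ) : ℝ))⁻¹) • gavgM (Matrix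 mm mm ℂ) (Fin (d + 1)) (kingPrV L i.kk i.r (cvM d L i.m i.kk hL)) A' μ x)))) (fun y y' => (CR * ((L : ℝ) ^ i.kk) ^ (-γR)) * Real.exp (-(δD * (unitTorusGeo L i.kk (cvM d L i.m i.kk hL)).dist y y')))) :
    NE2PlusOperator c35 (sfInstance d mm ι hL) (fun i => sfqrFamily d mm ι a e hL i (E i)) := by
  have hL2 : 2 ≤ L := le_trans (by norm_num) hL7
  have hL1r : (1 : ℝ) < (L : ℝ) := by exact_mod_cast hL.2
  have hLr : (0 : ℝ) < (L : ℝ) := by linarith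
  obtain ⟨C, δK, hC, hδK, HK⟩ := flatKernelRows_king (d := d) L hL.1 hL2 (a₀ := (1 : ℝ)) one_pos
  obtain ⟨δ₂, CS, P0, aP, hδ₂, hCS, hP0, haP, hS⟩ := hS
  refine ne2PlusOperator_sfqr_of_flatRows_mass d mm ι e hL hL7 ha hc35 he E hE
    ⟨min δK δ₂, C, C, C, CS, P0, aP, lt_min hδK hδ₂, hC.le, hC.le, hC.le, hCS, hP0, haP, fun i => ?_⟩ hD
  have hK1 : 1 ≤ i.kk := i.one_le
  have hK2 : 1 ≤ i.r + i.kk := hK1.trans (Nat.le_add_left _ _)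
  have hMc : ∀ μ, cvM d L i.m i.kk hL μ = 2 * L ^ (i.m + 1) := fun μ => rfl
  have hd0 := unitTorusGeo_dist_nonneg L i.kk (cvM d L i.m i.kk hL)
  obtain ⟨hG1c, hD1c, hA1c⟩ := HK i.kk hK1 (L ^ i.kk) rfl (i.m + 1) (cvM d L i.m i.kk hL) hMc i.kk ι
  obtain ⟨hG1f, hD1f, hA1f⟩ := HK (i.r + i.kk) hK2 (L ^ i.r * L ^ i.kk) (pow_add L i.r i.kk).symm (i.m + 1) (cvM d L i.m i.kk hL) hMc i.kk ι
  obtain ⟨hSc, hSf, hP⟩ := hS i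
  have hNc : (0 : ℝ) ≤ CS * ((L ^ i.kk : ℕ) : ℝ) ^ (d + 1) := by positivity
  have hNf : (0 : ℝ) ≤ CS * ((L ^ i.r * L ^ i.kk : ℕ) : ℝ) ^ (d + 1) := by positivity
  refine ⟨aK 1 (L : ℝ) i.kk, aK 1 (L : ℝ) (i.r + i.kk), aK_pos one_pos hL1r hK1, aK_le one_pos hL1r hK1, aK_pos one_pos hL1r hK2, aK_le one_pos hL1r hK2,
    ⟨hG1c.of_rate_le hd0 hC.le (min_le_left _ _), hA1c.of_rate_le hd0 hC.le (min_le_left _ _), hD1c.of_rate_le hd0 hC.le (min_le_left _ _), hSc.of_rate_le hd0 hNc (min_le_right _ _)⟩,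
    ⟨hG1f.of_rate_le hd0 hC.le (min_le_left _ _), hA1f.of_rate_le hd0 hC.le (min_le_left _ _), hD1f.of_rate_le hd0 hC.le (min_le_left _ _), hSf.of_rate_le hd0 hNf (min_le_right _ _)⟩,
    fun α₀ hα₀ hMa A' hA' => ?_⟩
  obtain ⟨hPc, hPf⟩ := hP α₀ hα₀ hMa A' hA'
  have hr0 : 0 ≤ P0 * (c35 * (L : ℝ) ^ i.m * α₀) := by positivity
  exact ⟨hPc.of_rate_le hd0 hr0 (min_le_right _ _), hPf.of_rate_le hd0 hr0 (min_le_right _ _)⟩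

end Node

end Summit.QuantumFields.YangMills.BalabanUVNodes.N15.Gluing

end
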